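import Summits.HodgeConjecture.HodgeConjecture.Theorems.PadicSemiregularLiftFormalLiftingFromClassLiftingGlue

/-!
# Skeleton — crux `FormalLiftingFromClassLifting` (stmt-HodgeConjecture-13825), line `hu` (lead a1-1)

Line = the `K₀` pair of the `hu-infinitesimal-obstruction` composition (round-2 card; payload slug
`IdeatorFiveSketch` as reshaped by lead a1-0, with the Porteous/det corner dropped): the crux follows
BY NAME from two closed `K₀`-statements through the LANDED glue
(`Glue.stepClassLifting_of_levelwiseLifts_of_kernelTower`, `Glue.liftsFormally_of_stepClassLifting`,
p76799):

* `stub_levelwiseClassLift` — level-wise (1_K): under the crux hypotheses a rationally pro-liftable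
  `[E₁]` lies in `im(K₀(X_{n+1}) → K₀(X_k))` for every `n` (paper: X. Hu, arXiv:2507.12458,
  Prop. 11.1 (i) at `(m, n) = (1, N)` + compatibility (Prop. 9.6) + torsion-freeness of
  `lim_N ℍ^{2r}(X_1, p(r)Ω•_{X_N})` under torsion-free Hodge cohomology + clearing denominators);
* `stub_kernelTower` — (2_K): kernel-tower surjectivity (paper: Hu Cor. 10.5 (i), `i = 0`, natural in
  the level, + surjectivity of `ℍ^{2r-1}(X_1, p(r)Ω•_{X_{N+1}}) → ℍ^{2r-1}(X_1, p(r)Ω•_{X_N})`).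

Both stubs are derived (later cycles of this line) from two NAMED FACTS stated over the p-adic de Rham
complex carrier (Hu Cor. 10.5 (i) / Prop. 11.1 (i), `Literature/AlgebraicGeometry/KTheory/`) and the
coherent lattice lemmas; the carrier-free algebraic cores of those lemmas are landed under
`Literature/Algebra/Homology/` as they close.
-/

set_option linter.dupNamespace false

namespace Summit.HodgeConjecture.HodgeConjecture.Theorems.FormalLiftingFromClassLifting.HuLine

open CategoryTheory AlgebraicGeometry Limits
open Literature.AlgebraicGeometry Literature.AlgebraicGeometry.Motives
open Literature.AlgebraicGeometry.Motives.WittScheme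
open Summit.HodgeConjecture.HodgeConjecture.Theses.PadicSemiregularLift
open Summit.HodgeConjecture.HodgeConjecture.Theorems.FormalLiftingFromClassLifting

noncomputable section

/-- **Stub (level-wise (1_K)).** Under the hypotheses of the crux on `𝒳`, a finite locally free `E₁`
on `X_k` whose rational class pro-lifts (Bloch–Esnault–Kerz Thm 1.3 (b), verbatim the crux's
hypothesis) has its INTEGRAL class in the image of `K₀(X_{n+1}) → K₀(X_k)` for every `n` (no
compatibility between the levels is asserted). -/
theorem stub_levelwiseClassLift :
    ∀ (p : ℕ) [Fact p.Prime] (k : Type) [Field k] [CharP k p] [PerfectRing k p] (d : ℕ)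
      (𝒳 : SchemeOver (WittVector p k)),
      IsSmoothProperModel d 𝒳 → Crystalline.IsProjectiveOverRing 𝒳 → d + 6 < p →
      (∀ (b : ℕ) (x : structureSheafCohomology 𝒳.left b), (p : ℤ) • x = 0 → x = 0) →
      (∀ (b : ℕ) (x : hodgeCohomologyOne 𝒳 b), (p : ℤ) • x = 0 → x = 0) →
      (d ≤ 3 ∨ Nonempty (cotangentSheaf 𝒳 ≅
        SheafOfModules.free (R := 𝒳.left.ringCatSheaf) (Fin d))) →
      ∀ (E₁ : (specialFibre 𝒳).left.Modules) (hE₁ : IsFiniteLocallyFree E₁),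
        (∃ ξ : KTheory.ContinuousKZeroRat (Ideal.span {(p : WittVector p k)}) 𝒳,
          KTheory.KZeroRat.map (Crystalline.specialFibreToTower 𝒳)
            (KTheory.ContinuousKZeroRat.specialFibre (Ideal.span {(p : WittVector p k)}) 𝒳 ξ) =
            KTheory.KZeroRat.of E₁ hE₁) →
        ∀ n : ℕ, ∃ z : KTheory.KZero (thickening 𝒳 (n + 1)).left,
          KTheory.KZero.map (specialFibreToThickening 𝒳 n) z = KTheory.KZero.of E₁ hE₁ := by
  sorry

/-- **Stub ((2_K) kernel tower).** Under the hypotheses of the crux on `𝒳`, every class on `X_{n+1}`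
dying on `X_k` is the restriction of a class on `X_{n+2}` dying on `X_k` (verbatim the hypothesis
`twoK` of the landed `Glue.glue_formalLiftingFromClassLifting_of_oneK_twoK`). -/
theorem stub_kernelTower :
    ∀ (p : ℕ) [Fact p.Prime] (k : Type) [Field k] [CharP k p] [PerfectRing k p] (d : ℕ)
      (𝒳 : SchemeOver (WittVector p k)),
      IsSmoothProperModel d 𝒳 → Crystalline.IsProjectiveOverRing 𝒳 → d + 6 < p →
      (∀ (b : ℕ) (x : structureSheafCohomology 𝒳.left b), (p : ℤ) • x = 0 → x = 0) →
      (∀ (b : ℕ) (x : hodgeCohomologyOne 𝒳 b), (p : ℤ) • x = 0 → x = 0) →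
      (d ≤ 3 ∨ Nonempty (cotangentSheaf 𝒳 ≅
        SheafOfModules.free (R := 𝒳.left.ringCatSheaf) (Fin d))) →
      ∀ (n : ℕ) (t : KTheory.KZero (thickening 𝒳 (n + 1)).left),
        KTheory.KZero.map (specialFibreToThickening 𝒳 n) t = 0 →
        ∃ t' : KTheory.KZero (thickening 𝒳 (n + 2)).left,
          KTheory.KZero.map (specialFibreToThickening 𝒳 (n + 1)) t' = 0 ∧
          KTheory.KZero.map (thickeningMap 𝒳 (Nat.le_succ (n + 1))) t' = t := by
  sorry

/-- **The crux from the two stubs** (composition of the line, sorry-free over the landed glue):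
level-wise lifts of `[E₁]` (`stub_levelwiseClassLift`) and kernel-tower surjectivity
(`stub_kernelTower`) give step class lifting for every finite-level lift of `E₁`
(`Glue.stepClassLifting_of_levelwiseLifts_of_kernelTower`), and hypothesis (⋆) of the crux climbs the
tower (`Glue.liftsFormally_of_stepClassLifting`). -/
theorem FormalLiftingFromClassLifting_of : FormalLiftingFromClassLifting := by
  intro p _ k _ _ _ d 𝒳 h𝒳 hproj hp hO hΩ hd E₁ hE₁ hstar hξ
  exact Glue.liftsFormally_of_stepClassLifting hE₁ hstar
    (Glue.stepClassLifting_of_levelwiseLifts_of_kernelTower hE₁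
      (stub_levelwiseClassLift p k d 𝒳 h𝒳 hproj hp hO hΩ hd E₁ hE₁ hξ)
      (stub_kernelTower p k d 𝒳 h𝒳 hproj hp hO hΩ hd))

end

end Summit.HodgeConjecture.HodgeConjecture.Theorems.FormalLiftingFromClassLifting.HuLine
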